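import Mathlib
import HarnessLib
import Literature.Analysis.FluidPDE.VectorCalculusProofs
import Literature.Analysis.FluidPDE.TaoEnstrophyLocalisation
import Literature.Analysis.FluidPDE.ClassicalSolution
import Literature.Analysis.FluidPDE.LeiZhang2011Proofs
import Summits.NavierStokesRegularity.NavierStokesRegularity.Theorems.UnthreadedDoorToroidalPotentialConstruction

/-!
# Route UnthreadedDoor · crux `PoloidalLiouville` (stmt-NavierStokesRegularity-1222, shared with
# route ThreadingFlux) · LINE «antidynamo» v2 — stub `stub_toroidalPotential` (2a), file 4/4:
# the TOROIDAL POTENTIAL, VERBATIM (`toroidalPotential : StubToroidalPotential`)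

Seat ns-es-p1 g4 (director-ns KEY-NS #139 (b)), `--supports stmt-NavierStokesRegularity-1222 --as helper`;
formalisation plan of ns-qj-p1 g3 (`TOROIDAL-POTENTIAL-PLAN.md`, evidence on 1222). Registered skeleton of
record: planner ns-idea-6 g5, `PoloidalLiouville_antidynamo_birth_v2.lean` (sha16 `4ebf5683127baf3c`); this
file proves its stub `StubToroidalPotential` VERBATIM (binders restated — a Theorems file cannot import the
planner's HOME skeleton; glue `example : StubToroidalPotential := toroidalPotential` elaborates, rc 0):

  if `v` is jointly `C^∞` on `(−∞,0) × ℝ³`, `‖curl v(t)‖ ≤ K` and `⟪x − x₀, curl v(t)(x)⟫ = 0` for all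
  `t < 0`, `x`, then there is `T : ℝ → ℝ³ → ℝ`, jointly `C^∞` on `(−∞,0) × (ℝ³ ∖ {x₀})`, with
  `|T| ≤ π K` and `curl v(t)(x) = ∇T(t)(x) × (x − x₀)` for all `t < 0` and all `x`.

THIS FILE: the great-circle estimate `abs_sub_pole_le_of_sphere` (`|Φ(x) − Φ(r e₃)| ≤ πK` when
`‖∇Φ‖ ≤ K/r` on the sphere `‖x‖ = r`: integrate along the arc `s ↦ r cos s e₃ + r sin s u` from the pole to
`x`, of length `θ r`, `θ = arccos(x₂/r) ≤ π`); the vorticity facts (`contDiffOn_uncurry_curl`: joint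
smoothness of `curl v`; `sum_fderiv_curl_apply_eq_zero`: `div curl = 0`; `eq_zero_of_sphere_tangent`: a
continuous sphere-tangent field vanishes at the centre); `toroidalPotential_zero` (centre `0`, from
`exists_toroidalPotential_zero` of file 3/4: `∇T = a x + ‖x‖⁻²(x × ω)` gives
`∇T × x = ‖x‖⁻²((x × ω) × x) = ω` as `ω ⊥ x`); and the translation `x ↦ x − x₀`.

NOTE (hypotheses): no `div v = 0` and no Navier–Stokes dynamics are used — only `div curl v = 0` and the
tangency `curl v ⊥ (x − x₀)`; the statement is pure kinematics at each fixed time.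

HONEST FRAMING: the Mie–Chandrasekhar representation of a HYPOTHETICAL bounded ancient solution's unthreaded
vorticity; it is the kinematic stub (2a) of a line whose wall (`stub_scalarLiouville`, XL) is OPEN. Nothing
here bears on `PoloidalLiouville` itself, on the UnthreadedDoor Target, or on Navier–Stokes regularity; no
summit statement is proved here.

References: G. Backus, Poloidal and toroidal fields in geomagnetic field modeling, Rev. Geophys. 24 (1986)
75–109, §2 [Backus1986]; S. Chandrasekhar, Hydrodynamic and Hydromagnetic Stability (1961), App. III
[Chandrasekhar1961].
-/

noncomputable section

open Set Filter Function Metric MeasureTheory intervalIntegral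
open scoped Topology RealInnerProductSpace ContDiff

set_option linter.dupNamespace false

namespace Summit.NavierStokesRegularity.NavierStokesRegularity.Theorems.PoloidalLiouville

open Literature.Analysis.FluidPDE

/-! ## The great-circle estimate `|Φ(x) − Φ(r e₃)| ≤ π K` -/

set_option maxHeartbeats 400000 in
/-- **Great-circle estimate.** If `Φ` has gradient `G` on `ℝ³ ∖ {0}` with `‖G‖ ≤ K/r` on the sphere of
radius `r > 0`, then `|Φ(x) − Φ(r e₃)| ≤ π K` for `‖x‖ = r`: integrate `⟪G(γ), γ'⟫` along the great-circle
arc `γ` from the pole `r e₃` to `x` (length `θ r ≤ π r`). [folklore] -/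
theorem abs_sub_pole_le_of_sphere {Φ : EuclideanSpace ℝ (Fin 3) → ℝ}
    {G : EuclideanSpace ℝ (Fin 3) → EuclideanSpace ℝ (Fin 3)} {r K : ℝ} (hr : 0 < r) (hK : 0 ≤ K)
    (hΦ : ∀ z : EuclideanSpace ℝ (Fin 3), z ≠ 0 → HasFDerivAt Φ (innerSL ℝ (G z)) z)
    (hG : ∀ z : EuclideanSpace ℝ (Fin 3), ‖z‖ = r → ‖G z‖ ≤ K / r)
    {x : EuclideanSpace ℝ (Fin 3)} (hx : ‖x‖ = r) :
    |Φ x - Φ (r • EuclideanSpace.single 2 1)| ≤ Real.pi * K := by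
  set e₃ : EuclideanSpace ℝ (Fin 3) := EuclideanSpace.single 2 1 with he₃
  set e₁ : EuclideanSpace ℝ (Fin 3) := EuclideanSpace.single 0 1 with he₁
  set c : ℝ := x 2 with hc
  set x' : EuclideanSpace ℝ (Fin 3) := x - c • e₃ with hx'
  have he₃n : ‖e₃‖ = 1 := by simp [he₃]
  have he₁n : ‖e₁‖ = 1 := by simp [he₁]
  have hxe₃ : ⟪x, e₃⟫ = c := by simp [he₃, EuclideanSpace.inner_single_right, hc]
  have he₃e₃ : ⟪e₃, e₃⟫ = 1 := by rw [real_inner_self_eq_norm_sq, he₃n, one_pow]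
  have hx'e₃ : ⟪x', e₃⟫ = 0 := by
    simp only [hx', inner_sub_left, inner_smul_left, hxe₃, he₃e₃, RCLike.conj_to_real, mul_one, sub_self]
  -- `‖x'‖² = r² − c²`
  have hx'n : ‖x'‖ ^ 2 = r ^ 2 - c ^ 2 := by
    have h1 : ‖x'‖ ^ 2 = ⟪x', x'⟫ := (real_inner_self_eq_norm_sq x').symm
    rw [h1]
    have : ⟪x', x'⟫ = ⟪x', x⟫ := by
      simp only [hx', inner_sub_right, inner_smul_right]
      rw [show ⟪x - c • e₃, e₃⟫ = 0 from hx'e₃, mul_zero, sub_zero]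
    rw [this, hx', inner_sub_left, inner_smul_left, real_inner_self_eq_norm_sq, hx,
      real_inner_comm, hxe₃, RCLike.conj_to_real]
    ring
  have hcr : |c| ≤ r := by
    have := abs_real_inner_le_norm x e₃
    rwa [hxe₃, hx, he₃n, mul_one] at this
  have hc1 : -1 ≤ c / r ∧ c / r ≤ 1 := by
    rw [← abs_le, abs_div, abs_of_pos hr, div_le_one hr]; exact hcr
  -- the unit tangent direction `u ⊥ e₃` with `‖x'‖ u = x'`
  obtain ⟨u, hun, hue₃, hux'⟩ : ∃ u : EuclideanSpace ℝ (Fin 3), ‖u‖ = 1 ∧ ⟪u, e₃⟫ = 0 ∧ ‖x'‖ • u = x' := by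
    by_cases h0 : x' = 0
    · refine ⟨e₁, he₁n, by simp [he₁, he₃, EuclideanSpace.inner_single_right], ?_⟩
      rw [h0, norm_zero, zero_smul]
    · refine ⟨‖x'‖⁻¹ • x', ?_, ?_, ?_⟩
      · rw [norm_smul, norm_inv, norm_norm, inv_mul_cancel₀ (norm_ne_zero_iff.2 h0)]
      · rw [inner_smul_left, hx'e₃, mul_zero]
      · rw [smul_smul, mul_inv_cancel₀ (norm_ne_zero_iff.2 h0), one_smul]
  have hue₃' : ⟪e₃, u⟫ = 0 := by rw [real_inner_comm]; exact hue₃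
  have huu : ⟪u, u⟫ = 1 := by rw [real_inner_self_eq_norm_sq, hun, one_pow]
  -- the angle and the great-circle arc
  set θ : ℝ := Real.arccos (c / r) with hθ
  have hcos : Real.cos θ = c / r := Real.cos_arccos hc1.1 hc1.2
  have hsin : r * Real.sin θ = ‖x'‖ := by
    rw [hθ, Real.sin_arccos]
    have h1 : r * √(1 - (c / r) ^ 2) = √(r ^ 2 * (1 - (c / r) ^ 2)) := by
      rw [Real.sqrt_mul' _ (by nlinarith [hc1.1, hc1.2, sq_nonneg (c / r)]), Real.sqrt_sq hr.le]
    rw [h1, ← Real.sqrt_sq (norm_nonneg x'), hx'n]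
    congr 1
    field_simp
  set γ : ℝ → EuclideanSpace ℝ (Fin 3) := fun s => (r * Real.cos s) • e₃ + (r * Real.sin s) • u with hγ
  set γ' : ℝ → EuclideanSpace ℝ (Fin 3) := fun s => (-(r * Real.sin s)) • e₃ + (r * Real.cos s) • u
    with hγ'
  have hγd : ∀ s, HasDerivAt γ (γ' s) s := fun s => by
    have h1 := ((Real.hasDerivAt_cos s).const_mul r).smul_const e₃
    have h2 := ((Real.hasDerivAt_sin s).const_mul r).smul_const u
    have h3 : γ' s = (r * -Real.sin s) • e₃ + (r * Real.cos s) • u := by simp [hγ', mul_neg]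
    rw [h3]
    exact h1.add h2
  -- norms on the arc: `‖γ s‖ = r`, `‖γ' s‖ = r`
  have hnorm : ∀ a b : ℝ, ‖a • e₃ + b • u‖ ^ 2 = a ^ 2 + b ^ 2 := fun a b => by
    rw [← real_inner_self_eq_norm_sq, inner_add_left, inner_add_right, inner_add_right,
      inner_smul_left, inner_smul_left, inner_smul_right, inner_smul_right, inner_smul_left,
      inner_smul_left, inner_smul_right, inner_smul_right, he₃e₃, hue₃, hue₃', huu]
    simp only [RCLike.conj_to_real]
    ring
  have hγn : ∀ s, ‖γ s‖ = r := fun s => by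
    have h := hnorm (r * Real.cos s) (r * Real.sin s)
    have h2 : (r * Real.cos s) ^ 2 + (r * Real.sin s) ^ 2 = r ^ 2 := by
      nlinarith [Real.cos_sq_add_sin_sq s]
    rw [h2] at h
    exact (sq_eq_sq₀ (norm_nonneg _) hr.le).1 h
  have hγ'n : ∀ s, ‖γ' s‖ = r := fun s => by
    have h := hnorm (-(r * Real.sin s)) (r * Real.cos s)
    have h2 : (-(r * Real.sin s)) ^ 2 + (r * Real.cos s) ^ 2 = r ^ 2 := by
      nlinarith [Real.cos_sq_add_sin_sq s]
    rw [h2] at h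
    exact (sq_eq_sq₀ (norm_nonneg _) hr.le).1 h
  have hγ0 : γ 0 = r • e₃ := by simp [hγ]
  have hγθ : γ θ = x := by
    simp only [hγ]
    rw [hcos, hsin, hux', mul_div_cancel₀ _ hr.ne', hx']
    abel
  -- derivative of `Φ ∘ γ` and the mean value inequality on `[0, θ]`
  have hfd : ∀ s, HasDerivAt (fun s => Φ (γ s)) ⟪G (γ s), γ' s⟫ s := fun s => by
    have hne : γ s ≠ 0 := by rw [← norm_ne_zero_iff, hγn]; exact hr.ne'
    have := (hΦ _ hne).comp_hasDerivAt s (hγd s)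
    simpa [Function.comp_def] using this
  have hbound : ∀ s ∈ Ico 0 θ, ‖⟪G (γ s), γ' s⟫‖ ≤ K := fun s _ => by
    rw [Real.norm_eq_abs]
    refine (abs_real_inner_le_norm _ _).trans ?_
    rw [hγ'n]
    have := hG (γ s) (hγn s)
    calc ‖G (γ s)‖ * r ≤ K / r * r := by gcongr
      _ = K := div_mul_cancel₀ K hr.ne'
  have hmv := norm_image_sub_le_of_norm_deriv_le_segment'
    (fun s _ => (hfd s).hasDerivWithinAt) hbound θ
    (right_mem_Icc.2 (Real.arccos_nonneg _))
  rw [hγθ, hγ0, Real.norm_eq_abs, sub_zero] at hmv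
  calc |Φ x - Φ (r • e₃)| ≤ K * θ := hmv
    _ ≤ K * Real.pi := by gcongr; exact Real.arccos_le_pi _
    _ = Real.pi * K := mul_comm _ _

/-! ## The vorticity of the class: joint smoothness, divergence, value at the centre -/

/-- A continuous field tangent to all spheres about the origin vanishes at the origin. [folklore] -/
theorem eq_zero_of_sphere_tangent {W : EuclideanSpace ℝ (Fin 3) → EuclideanSpace ℝ (Fin 3)}
    (hW : Continuous W) (htan : ∀ y, ⟪y, W y⟫ = 0) : W 0 = 0 := by
  suffices h : ∀ y : EuclideanSpace ℝ (Fin 3), ⟪y, W 0⟫ = 0 by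
    have := h (W 0); rwa [inner_self_eq_zero] at this
  intro y
  set f : ℝ → ℝ := fun s => ⟪y, W (s • y)⟫ with hf
  have hfc : Continuous f := continuous_const.inner (hW.comp (continuous_id.smul continuous_const))
  have hf0 : ∀ s : ℝ, s ≠ 0 → f s = 0 := fun s hs => by
    have h := htan (s • y)
    rw [inner_smul_left, RCLike.conj_to_real, mul_eq_zero] at h
    exact h.resolve_left hs
  have h1 : Tendsto f (𝓝[≠] 0) (𝓝 (f 0)) := hfc.continuousAt.tendsto.mono_left nhdsWithin_le_nhds
  have h2 : Tendsto f (𝓝[≠] 0) (𝓝 0) :=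
    tendsto_const_nhds.congr' (eventually_nhdsWithin_of_forall fun s hs => (hf0 s hs).symm)
  have h3 : f 0 = 0 := tendsto_nhds_unique h1 h2
  simpa [hf] using h3

/-- The vorticity `(t, x) ↦ curl v(t) x` of a velocity jointly smooth on `(−∞,0) × ℝ³` is jointly smooth
there. [folklore] -/
theorem contDiffOn_uncurry_curl {v : ℝ → EuclideanSpace ℝ (Fin 3) → EuclideanSpace ℝ (Fin 3)}
    (hv : ContDiffOn ℝ (⊤ : ℕ∞) (uncurry v) (Iio 0 ×ˢ univ)) :
    ContDiffOn ℝ ∞ (uncurry fun t x => curl (v t) x) (Iio 0 ×ˢ univ) := by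
  have hv' : IsSmoothSpaceTimeOn (Iio 0) v := hv
  have hD : IsSmoothSpaceTimeOn (Iio 0) (fun t x => fderiv ℝ (v t) x) :=
    hv'.fderiv_slice (uniqueDiffOn_Iio 0)
  exact curlCLM.contDiff.comp_contDiffOn hD

/-- `div curl v(t) = 0` in coordinates: `∑ᵢ ∂ᵢ (curl v(t))ᵢ = 0`. [folklore] -/
theorem sum_fderiv_curl_apply_eq_zero {V : EuclideanSpace ℝ (Fin 3) → EuclideanSpace ℝ (Fin 3)}
    (hV : ContDiff ℝ 2 V) (p : EuclideanSpace ℝ (Fin 3)) :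
    ∑ i, fderiv ℝ (curl V) p (EuclideanSpace.single i 1) i = 0 := by
  have h := divergence_curl_eq_zero_holds V hV p
  rwa [VectorCalculus.divergence, trace_eq_sum_coord] at h

/-! ## The toroidal potential: centre `0`, then a general centre -/

/-- **Toroidal potential, centre `0`.** If `v` is jointly smooth on `(−∞,0) × ℝ³`, `‖curl v(t)‖ ≤ K` and
`curl v(t)` is tangent to every sphere about the origin, there is `T`, jointly smooth on
`(−∞,0) × (ℝ³ ∖ {0})`, with `|T| ≤ π K` and `curl v(t) x = ∇T(t)(x) × x` for all `t < 0`, `x`.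
[folklore] -/
theorem toroidalPotential_zero (v : ℝ → EuclideanSpace ℝ (Fin 3) → EuclideanSpace ℝ (Fin 3)) (K : ℝ)
    (hv : ContDiffOn ℝ (⊤ : ℕ∞) (uncurry v) (Iio 0 ×ˢ univ))
    (hK : ∀ t < 0, ∀ x, ‖curl (v t) x‖ ≤ K) (htan : ∀ t < 0, ∀ x, ⟪x, curl (v t) x⟫ = 0) :
    ∃ T : ℝ → EuclideanSpace ℝ (Fin 3) → ℝ,
      ContDiffOn ℝ (⊤ : ℕ∞) (uncurry T) (Iio 0 ×ˢ ({0}ᶜ : Set (EuclideanSpace ℝ (Fin 3)))) ∧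
      (∀ t < 0, ∀ x, |T t x| ≤ Real.pi * K) ∧
      ∀ t < 0, ∀ x, curl (v t) x = cross (gradient (T t) x) x := by
  have hv' : IsSmoothSpaceTimeOn (Iio 0) v := hv
  have hK0 : 0 ≤ K := (norm_nonneg _).trans (hK (-1) (by norm_num) 0)
  have hdiv : ∀ t < 0, ∀ p : EuclideanSpace ℝ (Fin 3), p ≠ 0 →
      ∑ i, fderiv ℝ (fun x => curl (v t) x) p (EuclideanSpace.single i 1) i = 0 := fun t ht p _ =>
    sum_fderiv_curl_apply_eq_zero ((hv'.contDiff_slice ht).of_le (by norm_cast)) p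
  obtain ⟨T, hTs, hT0, hTg, hTr⟩ := exists_toroidalPotential_zero (Ω := fun t x => curl (v t) x)
    (contDiffOn_uncurry_curl hv) htan hdiv
  refine ⟨T, hTs, fun t ht x => ?_, fun t ht x => ?_⟩
  · -- the bound
    by_cases hx : x = 0
    · rw [hx, hT0, abs_zero]; positivity
    have hr : 0 < ‖x‖ := norm_pos_iff.2 hx
    obtain ⟨Φ, hΦ, hrep⟩ := hTr t ht ‖x‖ hr
    rw [hrep x hx rfl]
    refine abs_sub_pole_le_of_sphere hr hK0 hΦ (fun z hz => ?_) rfl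
    have hz0 : z ≠ 0 := by rw [← norm_ne_zero_iff, hz]; exact hr.ne'
    rw [hz, div_self hr.ne', one_smul, norm_smul, norm_inv, norm_pow, norm_norm]
    calc (‖x‖ ^ 2)⁻¹ * ‖cross z (curl (v t) z)‖ ≤ (‖x‖ ^ 2)⁻¹ * (‖x‖ * K) := by
          gcongr
          calc ‖cross z (curl (v t) z)‖ ≤ ‖z‖ * ‖curl (v t) z‖ := norm_cross_le_norm_mul_norm _ _
            _ ≤ ‖x‖ * K := by rw [hz]; gcongr; exact hK t ht z
      _ = K / ‖x‖ := by field_simp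
  · -- the representation `curl v = ∇T × x`
    -- algebra of `cross` in the first argument (via the bilinear map `crossCLM`)
    have cross_zero_right : ∀ a : EuclideanSpace ℝ (Fin 3), cross a 0 = 0 := fun a => by
      rw [← crossCLM_apply, map_zero]
    have cross_self_eq_zero : ∀ a : EuclideanSpace ℝ (Fin 3), cross a a = 0 := fun a => by
      simp [cross]
    have cross_smul_left_eq : ∀ (c : ℝ) (a b : EuclideanSpace ℝ (Fin 3)),
        cross (c • a) b = c • cross a b := fun c a b => by
      rw [← crossCLM_apply, ← crossCLM_apply, map_smul, smul_apply]
    have cross_smul_add_left : ∀ (a : ℝ) (x b y : EuclideanSpace ℝ (Fin 3)),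
        cross (a • x + b) y = a • cross x y + cross b y := fun a x b y => by
      rw [← crossCLM_apply, ← crossCLM_apply, ← crossCLM_apply, map_add, map_smul]; rfl
    by_cases hx : x = 0
    · rw [hx, cross_zero_right]
      exact eq_zero_of_sphere_tangent
        ((contDiff_curl (n := 0) ((hv'.contDiff_slice ht).of_le (by norm_cast))).continuous)
        (htan t ht)
    obtain ⟨a, ha⟩ := hTg t ht x hx
    have hg : gradient (T t) x = a • x + (‖x‖ ^ 2)⁻¹ • cross x (curl (v t) x) := by
      refine HasGradientAt.gradient ?_
      rw [hasGradientAt_iff_hasFDerivAt]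
      have hd : (InnerProductSpace.toDual ℝ (EuclideanSpace ℝ (Fin 3))
          (a • x + (‖x‖ ^ 2)⁻¹ • cross x (curl (v t) x)) : EuclideanSpace ℝ (Fin 3) →L[ℝ] ℝ) =
          innerSL ℝ (a • x + (‖x‖ ^ 2)⁻¹ • cross x (curl (v t) x)) := by
        ext y
        simp [InnerProductSpace.toDual_apply_apply]
      rw [hd]
      exact ha
    rw [hg, cross_smul_add_left, cross_self_eq_zero, smul_zero, zero_add, cross_smul_left_eq,
      cross_cross_self, htan t ht x, zero_smul, sub_zero, smul_smul,
      inv_mul_cancel₀ (pow_ne_zero _ (norm_ne_zero_iff.2 hx)), one_smul]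

/-- **Stub `stub_toroidalPotential` (2a) of the registered v2 skeleton of crux `PoloidalLiouville`
(stmt-NavierStokesRegularity-1222; LINE «antidynamo», planner ns-idea-6 g5, sha16 `4ebf5683127baf3c`),
signature VERBATIM (`StubToroidalPotential`): the TOROIDAL (Mie–Chandrasekhar) POTENTIAL of an unthreaded
vorticity field.** If `v` is jointly `C^∞` on `(−∞,0) × ℝ³`, `‖curl v(t)‖ ≤ K`, and `curl v(t)` is tangent to
every sphere about `x₀`, then there is a scalar `T`, jointly `C^∞` on the punctured slab
`(−∞,0) × (ℝ³ ∖ {x₀})`, with `|T| ≤ π K` and `curl v(t)(x) = ∇T(t)(x) × (x − x₀)` for all `t < 0` and ALL `x`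
(at `x₀` both sides vanish). Proof: translate to `x₀ = 0` and apply `toroidalPotential_zero` (files 1–3:
the sphere form `‖y‖⁻²(y × ω)` is closed on spheres because `div ω = 0` and `ω ⊥ y` — no `div v = 0` is
used; its radial pull-back is a closed form on `ℝ³ ∖ {0}`, hence a gradient by the tree's Poincaré lemma;
`T` = chord integrals from the pole ray, smooth by differentiation under the integral sign; gauge
`T(t, x₀ + r e₃) = 0`, bound by a great-circle estimate).
[cite: Backus1986, §2 (Mie representation of solenoidal fields tangent to spheres); cf. Chandrasekhar 1961, App. III] -/
theorem toroidalPotential :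
    ∀ (v : ℝ → EuclideanSpace ℝ (Fin 3) → EuclideanSpace ℝ (Fin 3)) (x₀ : EuclideanSpace ℝ (Fin 3)) (K : ℝ),
    ContDiffOn ℝ (⊤ : ℕ∞) (Function.uncurry v) (Set.Iio 0 ×ˢ Set.univ) →
    (∀ t < 0, ∀ x, ‖Literature.Analysis.FluidPDE.curl (v t) x‖ ≤ K) →
    (∀ t < 0, ∀ x, inner ℝ (x - x₀) (Literature.Analysis.FluidPDE.curl (v t) x) = 0) →
    ∃ T : ℝ → EuclideanSpace ℝ (Fin 3) → ℝ,
      ContDiffOn ℝ (⊤ : ℕ∞) (Function.uncurry T) (Set.Iio 0 ×ˢ ({x₀}ᶜ : Set (EuclideanSpace ℝ (Fin 3)))) ∧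
      (∀ t < 0, ∀ x, |T t x| ≤ Real.pi * K) ∧
      ∀ t < 0, ∀ x, Literature.Analysis.FluidPDE.curl (v t) x =
        Literature.Analysis.FluidPDE.cross (gradient (T t) x) (x - x₀) := by
  intro v x₀ K hv hK htan
  set w : ℝ → EuclideanSpace ℝ (Fin 3) → EuclideanSpace ℝ (Fin 3) := fun t z => v t (z + x₀) with hw
  have hwv : ContDiffOn ℝ (⊤ : ℕ∞) (uncurry w) (Iio 0 ×ˢ univ) :=
    hv.comp (contDiff_fst.prodMk (contDiff_snd.add contDiff_const)).contDiffOn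
      (fun q hq => ⟨hq.1, mem_univ _⟩)
  have hcurl : ∀ t z, curl (w t) z = curl (v t) (z + x₀) := fun t z => by
    simp only [curl_eq_curlCLM, hw, fderiv_comp_add_right]
  obtain ⟨T, hTs, hTb, hTc⟩ := toroidalPotential_zero w K hwv
    (fun t ht z => by rw [hcurl]; exact hK t ht _)
    (fun t ht z => by rw [hcurl]; simpa using htan t ht (z + x₀))
  refine ⟨fun t x => T t (x - x₀), ?_, fun t ht x => hTb t ht _, fun t ht x => ?_⟩
  · refine hTs.comp (contDiff_fst.prodMk (contDiff_snd.sub contDiff_const)).contDiffOn ?_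
    rintro ⟨t, x⟩ ⟨ht, hx⟩
    refine ⟨ht, ?_⟩
    simp only [mem_compl_iff, mem_singleton_iff] at hx ⊢
    exact sub_ne_zero.2 hx
  · have hg : gradient (fun x => T t (x - x₀)) x = gradient (T t) (x - x₀) := by
      simp only [gradient, sub_eq_add_neg, fderiv_comp_add_right]
    have h1 := hTc t ht (x - x₀)
    rw [hcurl, sub_add_cancel] at h1
    show curl (v t) x = cross (gradient (fun x => T t (x - x₀)) x) (x - x₀)
    rw [hg]
    exact h1

/-- Alias under the skeleton's stub name. [folklore] -/
theorem stub_toroidalPotential :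
    ∀ (v : ℝ → EuclideanSpace ℝ (Fin 3) → EuclideanSpace ℝ (Fin 3)) (x₀ : EuclideanSpace ℝ (Fin 3)) (K : ℝ),
    ContDiffOn ℝ (⊤ : ℕ∞) (Function.uncurry v) (Set.Iio 0 ×ˢ Set.univ) →
    (∀ t < 0, ∀ x, ‖Literature.Analysis.FluidPDE.curl (v t) x‖ ≤ K) →
    (∀ t < 0, ∀ x, inner ℝ (x - x₀) (Literature.Analysis.FluidPDE.curl (v t) x) = 0) →
    ∃ T : ℝ → EuclideanSpace ℝ (Fin 3) → ℝ,
      ContDiffOn ℝ (⊤ : ℕ∞) (Function.uncurry T) (Set.Iio 0 ×ˢ ({x₀}ᶜ : Set (EuclideanSpace ℝ (Fin 3)))) ∧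
      (∀ t < 0, ∀ x, |T t x| ≤ Real.pi * K) ∧
      ∀ t < 0, ∀ x, Literature.Analysis.FluidPDE.curl (v t) x =
        Literature.Analysis.FluidPDE.cross (gradient (T t) x) (x - x₀) :=
  toroidalPotential

end Summit.NavierStokesRegularity.NavierStokesRegularity.Theorems.PoloidalLiouville

end
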